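import Summits.NavierStokesRegularity.NavierStokesRegularity.Theorems.AxisymmetricExtremalityAxisymmetricKatoGlobalStubSeregin2020TypeIILemma22ExcisionErrorTools
import HarnessLib

/-!
# Seregin 2020, Lemma 2.2 (after Nazarov–Uraltseva 2012), piece L22-B (the energy class across the
# axis), step F3b.4 (e2): the DRIFT excision error

Helper toward the stub `stub_seregin2020TypeII` of the crux `AxisymmetricKatoGlobal` (Seregin 2020,
Thm 2.1 ⇐ Lemma 2.2 = N–U 2012 Lemma 4.2 in the class 𝒱), piece L22-B (route P, kit `A1-L22B-F3`,
texts of record of 2026-08-28): with the test function `Θ ∏_{i∈A}(1-ψᵢ)` (active balls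
`B(xᵢ,4rᵢ)` excised) the product rule `gradient_cutoffProduct_sq` leaves the error integrand
`η H(Φ) ⟪U, Θ² ∇(∏(1-ψᵢ))²⟫`; `excision_driftError_le` proves it integrable on a time step
`[a,b] × ℝ³` with `L¹` norm `≤ K Σ_{i∈A} rᵢ⁻¹ ∫∫_{[a,b]×(B(xᵢ,4rᵢ)∩B(0,2R))} |U|`, LINEAR in the
balls: the global accounting sums the steps first (ball `i` active for total time `≤ 4rᵢ²`) and
applies Hölder once per ball (`lintegral_enorm_le_cube_holder`), `rᵢ⁻¹‖U‖₃(4rᵢ²|B(4rᵢ)|)^{2/3} =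
C‖U‖₃ rᵢ^{7/3} → 0`. No Navier–Stokes statement is proved here.

## References

* A. I. Nazarov, N. N. Uraltseva, St. Petersburg Math. J. 23 (2012) 93–115 = arXiv:1011.1888,
  §4, Lemma 4.2 (the class with the singular drift `2x'/|x'|²`). [NazarovUraltseva2012]
* G. Seregin, Anal. Math. Phys. 10 (2020) 46 = arXiv:2006.04140, Lemma 2.2, class 𝒱 (the set `S`
  of parabolic Hausdorff dimension `≤ 1` on the axis). [Seregin2020]
-/

-- the problem directory repeats the summit name (D-0017); core's `dupNamespace` linter fires
set_option linter.dupNamespace false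

noncomputable section

open MeasureTheory Set Function Filter Topology TopologicalSpace Metric
open scoped NNReal ENNReal InnerProductSpace

namespace Summit.NavierStokesRegularity.NavierStokesRegularity.Theorems.AxisymmetricKatoGlobal.EulerScaling

open Literature.Analysis.FluidPDE Literature.Analysis.FluidPDE.Seregin2020

/-! ### (e2) the drift excision error -/

set_option maxHeartbeats 800000 in
/-- **(e2) The drift excision error.** Fix a drift `U` (a.e.-strongly measurable, with
`∫∫_{[t₁,t₂]×B(0,2R)} |U|³ < ∞`), `Φ ≥ 0` (jointly measurable), a `C²` profile `H ≥ 0` with `H' ≤ 0`,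
a `C¹` test function `Θ` supported in `B(0,2R)`, a `C¹` time weight `η` and `C₀ ≥ 0`. There is
`K ≥ 0` such that for every finite family of `C¹` bumps `ψᵢ ∈ [0,1]`, `‖Dψᵢ‖ ≤ C₀/rᵢ`, `Dψᵢ = 0`
off `B(xᵢ,4rᵢ)` (`i ∈ A`), and every step `[a,b] ⊆ [t₁,t₂]`, the error integrand
`η H(Φ) ⟪U, Θ² ∇(∏_{i∈A}(1-ψᵢ))²⟫` is integrable on `[a,b] × ℝ³` with
`∫∫ |η H(Φ) ⟪U, Θ² ∇(∏(1-ψᵢ))²⟫| ≤ K Σ_{i∈A} rᵢ⁻¹ ∫∫_{[a,b]×(B(xᵢ,4rᵢ)∩B(0,2R))} |U|`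
— linear in the balls, so that the steps are summed FIRST (ball `i` active for total time `≤ 4rᵢ²`)
and Hölder (`lintegral_enorm_le_cube_holder`) is applied once per ball:
`rᵢ⁻¹ ‖U‖₃ (4rᵢ² |B(4rᵢ)|)^{2/3} = C ‖U‖₃ rᵢ^{7/3}`. Step F3b.4 (e2) of the passage of the energy
class across the axis set `S`.
[cite: NazarovUraltseva2012, §4, proof of Lemma 4.2 (the drift term); Seregin2020, Lemma 2.2] -/
theorem excision_driftError_le
    {U : ℝ → EuclideanSpace ℝ (Fin 3) → EuclideanSpace ℝ (Fin 3)} {Φ : ℝ → EuclideanSpace ℝ (Fin 3) → ℝ}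
    {H : ℝ → ℝ} {Θ : EuclideanSpace ℝ (Fin 3) → ℝ} {η : ℝ → ℝ} {R t₁ t₂ C₀ : ℝ}
    (hUm : AEStronglyMeasurable (uncurry U) volume)
    (hU3 : ∫⁻ z in Icc t₁ t₂ ×ˢ ball (0 : EuclideanSpace ℝ (Fin 3)) (2 * R), ‖U z.1 z.2‖ₑ ^ (3 : ℕ) < ⊤)
    (hΦm : Measurable (uncurry Φ)) (hΦ0 : ∀ t x, 0 ≤ Φ t x)
    (hH : ContDiff ℝ 2 H) (hH' : ∀ v, deriv H v ≤ 0) (hH0 : ∀ v, 0 ≤ H v)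
    (hΘ : ContDiff ℝ 1 Θ) (hΘc : HasCompactSupport Θ)
    (hΘs : tsupport Θ ⊆ ball (0 : EuclideanSpace ℝ (Fin 3)) (2 * R))
    (hη : ContDiff ℝ 1 η) (hC₀ : 0 ≤ C₀) :
    ∃ K : ℝ, 0 ≤ K ∧ ∀ (A : Finset ℕ) (x : ℕ → EuclideanSpace ℝ (Fin 3)) (r : ℕ → ℝ)
      (ψ : ℕ → EuclideanSpace ℝ (Fin 3) → ℝ) (a b : ℝ), t₁ ≤ a → a ≤ b → b ≤ t₂ →
      (∀ i ∈ A, 0 < r i) → (∀ i ∈ A, ContDiff ℝ 1 (ψ i)) → (∀ i ∈ A, ∀ y, 0 ≤ ψ i y ∧ ψ i y ≤ 1) →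
      (∀ i ∈ A, ∀ y, ‖fderiv ℝ (ψ i) y‖ ≤ C₀ / r i) →
      (∀ i ∈ A, ∀ y, y ∉ ball (x i) (4 * r i) → fderiv ℝ (ψ i) y = 0) →
      IntegrableOn (fun z : ℝ × EuclideanSpace ℝ (Fin 3) => η z.1 * (H (Φ z.1 z.2) *
          inner ℝ (U z.1 z.2) ((Θ z.2 ^ 2) • gradient (fun y => (∏ i ∈ A, (1 - ψ i y)) ^ 2) z.2)))
        (Icc a b ×ˢ univ) volume ∧
      ∫ z in Icc a b ×ˢ (univ : Set (EuclideanSpace ℝ (Fin 3))), |η z.1 * (H (Φ z.1 z.2) *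
          inner ℝ (U z.1 z.2) ((Θ z.2 ^ 2) • gradient (fun y => (∏ i ∈ A, (1 - ψ i y)) ^ 2) z.2))|
        ≤ K * ∑ i ∈ A, (r i)⁻¹ *
          ∫ z in Icc a b ×ˢ (ball (x i) (4 * r i) ∩ ball (0 : EuclideanSpace ℝ (Fin 3)) (2 * R)),
            ‖U z.1 z.2‖ := by
  classical
  -- bounds of the fixed data
  obtain ⟨Mη, hMη0, hMη⟩ : ∃ M : ℝ, 0 ≤ M ∧ ∀ t ∈ Icc t₁ t₂, |η t| ≤ M := by
    obtain ⟨M, hM⟩ := isCompact_Icc.exists_bound_of_continuousOn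
      (hη.continuous.continuousOn (s := Icc t₁ t₂))
    refine ⟨max M 0, le_max_right _ _, fun t ht => ?_⟩
    exact ((Real.norm_eq_abs _).symm.le.trans (hM t ht)).trans (le_max_left _ _)
  obtain ⟨CΘ, hCΘ0, hCΘ⟩ : ∃ C : ℝ, 0 ≤ C ∧ ∀ y, |Θ y| ≤ C := by
    obtain ⟨C, hC⟩ := hΘ.continuous.bounded_above_of_compact_support hΘc
    refine ⟨max C 0, le_max_right _ _, fun y => ?_⟩
    exact ((Real.norm_eq_abs _).symm.le.trans (hC y)).trans (le_max_left _ _)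
  have hHanti : Antitone H := antitone_of_deriv_nonpos (hH.differentiable two_ne_zero) hH'
  have hHle : ∀ t y, H (Φ t y) ≤ H 0 := fun t y => hHanti (hΦ0 t y)
  have hH00 : 0 ≤ H 0 := hH0 0
  have hΘ0 : ∀ y, y ∉ ball (0 : EuclideanSpace ℝ (Fin 3)) (2 * R) → Θ y = 0 :=
    fun y hy => image_eq_zero_of_notMem_tsupport fun h => hy (hΘs h)
  -- `U` is integrable on the big box
  have hbox : volume (Icc t₁ t₂ ×ˢ ball (0 : EuclideanSpace ℝ (Fin 3)) (2 * R)) ≠ ⊤ := by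
    rw [Measure.volume_eq_prod, Measure.prod_prod, Real.volume_Icc]
    exact ENNReal.mul_ne_top ENNReal.ofReal_ne_top measure_ball_lt_top.ne
  have hUint : IntegrableOn (fun z : ℝ × EuclideanSpace ℝ (Fin 3) => U z.1 z.2)
      (Icc t₁ t₂ ×ˢ ball (0 : EuclideanSpace ℝ (Fin 3)) (2 * R)) volume :=
    integrableOn_of_lintegral_cube_lt_top hUm hU3 hbox
  refine ⟨2 * Mη * H 0 * CΘ ^ 2 * C₀, by positivity, ?_⟩
  intro A x r ψ a b hta hab hbt hr hψ h01 hD hD0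
  have hSm : MeasurableSet (Icc a b ×ˢ (univ : Set (EuclideanSpace ℝ (Fin 3)))) :=
    measurableSet_Icc.prod MeasurableSet.univ
  have hPsq : ContDiff ℝ 1 (fun y => (∏ i ∈ A, (1 - ψ i y)) ^ 2) := (contDiff_prodCut hψ).pow 2
  have hDer := norm_gradient_prodCut_sq_le hψ h01 hD hD0
  have hTm : ∀ i, MeasurableSet ((univ : Set ℝ) ×ˢ
      (ball (x i) (4 * r i) ∩ ball (0 : EuclideanSpace ℝ (Fin 3)) (2 * R))) :=
    fun i => MeasurableSet.univ.prod (measurableSet_ball.inter measurableSet_ball)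
  -- ### the indicator terms of the majorant
  have hterm : ∀ i ∈ A,
      IntegrableOn (((univ : Set ℝ) ×ˢ (ball (x i) (4 * r i) ∩ ball (0 : EuclideanSpace ℝ (Fin 3)) (2 * R))).indicator
        fun z : ℝ × EuclideanSpace ℝ (Fin 3) => ‖U z.1 z.2‖) (Icc a b ×ˢ univ) volume ∧
      ∫ z in Icc a b ×ˢ (univ : Set (EuclideanSpace ℝ (Fin 3))),
          ((univ : Set ℝ) ×ˢ (ball (x i) (4 * r i) ∩ ball (0 : EuclideanSpace ℝ (Fin 3)) (2 * R))).indicator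
            (fun z : ℝ × EuclideanSpace ℝ (Fin 3) => ‖U z.1 z.2‖) z =
        ∫ z in Icc a b ×ˢ (ball (x i) (4 * r i) ∩ ball (0 : EuclideanSpace ℝ (Fin 3)) (2 * R)),
          ‖U z.1 z.2‖ := by
    intro i hi
    have hset : ((univ : Set ℝ) ×ˢ (ball (x i) (4 * r i) ∩ ball (0 : EuclideanSpace ℝ (Fin 3)) (2 * R))) ∩
        (Icc a b ×ˢ (univ : Set (EuclideanSpace ℝ (Fin 3)))) =
        Icc a b ×ˢ (ball (x i) (4 * r i) ∩ ball (0 : EuclideanSpace ℝ (Fin 3)) (2 * R)) := by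
      rw [prod_inter_prod, univ_inter, inter_univ]
    have hset' : (Icc a b ×ˢ (univ : Set (EuclideanSpace ℝ (Fin 3)))) ∩
        ((univ : Set ℝ) ×ˢ (ball (x i) (4 * r i) ∩ ball (0 : EuclideanSpace ℝ (Fin 3)) (2 * R))) =
        Icc a b ×ˢ (ball (x i) (4 * r i) ∩ ball (0 : EuclideanSpace ℝ (Fin 3)) (2 * R)) := by
      rw [prod_inter_prod, inter_univ, univ_inter]
    have hsub : Icc a b ×ˢ (ball (x i) (4 * r i) ∩ ball (0 : EuclideanSpace ℝ (Fin 3)) (2 * R)) ⊆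
        Icc t₁ t₂ ×ˢ ball (0 : EuclideanSpace ℝ (Fin 3)) (2 * R) :=
      prod_mono (Icc_subset_Icc hta hbt) inter_subset_right
    have hint : IntegrableOn (fun z : ℝ × EuclideanSpace ℝ (Fin 3) => ‖U z.1 z.2‖)
        (Icc a b ×ˢ (ball (x i) (4 * r i) ∩ ball (0 : EuclideanSpace ℝ (Fin 3)) (2 * R))) volume :=
      (hUint.mono_set hsub).norm
    refine ⟨(integrableOn_indicator_iff (hTm i)).2 (by rwa [hset]), ?_⟩
    rw [setIntegral_indicator (hTm i), hset']
  -- ### the majorant `G = Σ_i c_i 1_{ℝ×(B_i∩B(0,2R))} |U|`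
  obtain ⟨c, hc⟩ : ∃ c : ℕ → ℝ, c = fun i => 2 * Mη * H 0 * CΘ ^ 2 * (C₀ / r i) := ⟨_, rfl⟩
  have hc0 : ∀ i ∈ A, 0 ≤ c i := by
    intro i hi; rw [hc]; have := hr i hi; positivity
  have hGint : Integrable (fun z : ℝ × EuclideanSpace ℝ (Fin 3) => ∑ i ∈ A, c i *
      ((univ : Set ℝ) ×ˢ (ball (x i) (4 * r i) ∩ ball (0 : EuclideanSpace ℝ (Fin 3)) (2 * R))).indicator
        (fun z : ℝ × EuclideanSpace ℝ (Fin 3) => ‖U z.1 z.2‖) z)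
      (volume.restrict (Icc a b ×ˢ univ)) :=
    integrable_finsetSum _ fun i hi => (hterm i hi).1.const_mul (c i)
  have hG0 : ∀ z : ℝ × EuclideanSpace ℝ (Fin 3), 0 ≤ ∑ i ∈ A, c i *
      ((univ : Set ℝ) ×ˢ (ball (x i) (4 * r i) ∩ ball (0 : EuclideanSpace ℝ (Fin 3)) (2 * R))).indicator
        (fun z : ℝ × EuclideanSpace ℝ (Fin 3) => ‖U z.1 z.2‖) z :=
    fun z => Finset.sum_nonneg fun i hi => mul_nonneg (hc0 i hi)
      (indicator_nonneg (fun w _ => norm_nonneg _) _)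
  -- ### the pointwise bound on the step
  have hbound : ∀ z : ℝ × EuclideanSpace ℝ (Fin 3), z.1 ∈ Icc a b →
      |η z.1 * (H (Φ z.1 z.2) *
          inner ℝ (U z.1 z.2) ((Θ z.2 ^ 2) • gradient (fun y => (∏ i ∈ A, (1 - ψ i y)) ^ 2) z.2))| ≤
        ∑ i ∈ A, c i *
          ((univ : Set ℝ) ×ˢ (ball (x i) (4 * r i) ∩ ball (0 : EuclideanSpace ℝ (Fin 3)) (2 * R))).indicator
            (fun z : ℝ × EuclideanSpace ℝ (Fin 3) => ‖U z.1 z.2‖) z := by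
    intro z hz
    by_cases hzB : z.2 ∈ ball (0 : EuclideanSpace ℝ (Fin 3)) (2 * R)
    · have hηz : |η z.1| ≤ Mη := hMη z.1 ⟨hta.trans hz.1, hz.2.trans hbt⟩
      have hHz : |H (Φ z.1 z.2)| ≤ H 0 := by rw [abs_of_nonneg (hH0 _)]; exact hHle _ _
      have hΘz : |Θ z.2 ^ 2| ≤ CΘ ^ 2 := by
        rw [abs_pow]; exact pow_le_pow_left₀ (abs_nonneg _) (hCΘ _) 2
      have hDz := hDer z.2
      have hinner : |inner ℝ (U z.1 z.2) ((Θ z.2 ^ 2) •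
          gradient (fun y => (∏ i ∈ A, (1 - ψ i y)) ^ 2) z.2)| ≤
          ‖U z.1 z.2‖ * (|Θ z.2 ^ 2| * ‖gradient (fun y => (∏ i ∈ A, (1 - ψ i y)) ^ 2) z.2‖) := by
        refine (abs_real_inner_le_norm _ _).trans (le_of_eq ?_)
        rw [norm_smul, Real.norm_eq_abs]
      have hind : ∀ i, ‖U z.1 z.2‖ * (ball (x i) (4 * r i)).indicator (fun _ => (1 : ℝ)) z.2 =
          ((univ : Set ℝ) ×ˢ (ball (x i) (4 * r i) ∩ ball (0 : EuclideanSpace ℝ (Fin 3)) (2 * R))).indicator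
            (fun z : ℝ × EuclideanSpace ℝ (Fin 3) => ‖U z.1 z.2‖) z := by
        intro i
        by_cases h : z.2 ∈ ball (x i) (4 * r i)
        · rw [indicator_of_mem h, indicator_of_mem (show z ∈ (univ : Set ℝ) ×ˢ
            (ball (x i) (4 * r i) ∩ ball (0 : EuclideanSpace ℝ (Fin 3)) (2 * R)) from
              ⟨mem_univ _, h, hzB⟩), mul_one]
        · rw [indicator_of_notMem h, indicator_of_notMem (show z ∉ (univ : Set ℝ) ×ˢ
            (ball (x i) (4 * r i) ∩ ball (0 : EuclideanSpace ℝ (Fin 3)) (2 * R)) from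
              fun hz' => h hz'.2.1), mul_zero]
      rw [abs_mul, abs_mul]
      calc |η z.1| * (|H (Φ z.1 z.2)| * |inner ℝ (U z.1 z.2) ((Θ z.2 ^ 2) •
            gradient (fun y => (∏ i ∈ A, (1 - ψ i y)) ^ 2) z.2)|)
          ≤ Mη * (H 0 * (‖U z.1 z.2‖ * (CΘ ^ 2 *
              (2 * ∑ i ∈ A, C₀ / r i * (ball (x i) (4 * r i)).indicator (fun _ => (1 : ℝ)) z.2)))) := by
            refine mul_le_mul hηz (mul_le_mul hHz (hinner.trans (mul_le_mul_of_nonneg_left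
              (mul_le_mul hΘz hDz (norm_nonneg _) (sq_nonneg _)) (norm_nonneg _)))
              (abs_nonneg _) hH00) (by positivity) hMη0
        _ = ∑ i ∈ A, c i *
            ((univ : Set ℝ) ×ˢ (ball (x i) (4 * r i) ∩ ball (0 : EuclideanSpace ℝ (Fin 3)) (2 * R))).indicator
              (fun z : ℝ × EuclideanSpace ℝ (Fin 3) => ‖U z.1 z.2‖) z := by
            rw [show Mη * (H 0 * (‖U z.1 z.2‖ * (CΘ ^ 2 *
                (2 * ∑ i ∈ A, C₀ / r i * (ball (x i) (4 * r i)).indicator (fun _ => (1 : ℝ)) z.2)))) =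
                (2 * Mη * H 0 * CΘ ^ 2 * ‖U z.1 z.2‖) *
                  ∑ i ∈ A, C₀ / r i * (ball (x i) (4 * r i)).indicator (fun _ => (1 : ℝ)) z.2 by ring,
              Finset.mul_sum]
            refine Finset.sum_congr rfl fun i _ => ?_
            rw [← hind i, hc]
            ring
    · -- off `B(0,2R)` the test function vanishes
      have h0 : η z.1 * (H (Φ z.1 z.2) *
          inner ℝ (U z.1 z.2) ((Θ z.2 ^ 2) • gradient (fun y => (∏ i ∈ A, (1 - ψ i y)) ^ 2) z.2)) = 0 := by
        rw [hΘ0 z.2 hzB, zero_pow two_ne_zero, zero_smul, inner_zero_right, mul_zero, mul_zero]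
      rw [h0, abs_zero]
      exact hG0 z
  -- ### measurability of the integrand
  have hfm : AEStronglyMeasurable (fun z : ℝ × EuclideanSpace ℝ (Fin 3) => η z.1 * (H (Φ z.1 z.2) *
      inner ℝ (U z.1 z.2) ((Θ z.2 ^ 2) • gradient (fun y => (∏ i ∈ A, (1 - ψ i y)) ^ 2) z.2)))
      (volume.restrict (Icc a b ×ˢ univ)) := by
    have h1 : Measurable fun z : ℝ × EuclideanSpace ℝ (Fin 3) => η z.1 :=
      (hη.continuous.comp continuous_fst).measurable
    have h3 : Measurable fun z : ℝ × EuclideanSpace ℝ (Fin 3) => H (Φ z.1 z.2) :=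
      hH.continuous.measurable.comp hΦm
    have hg : Continuous (gradient (fun y => (∏ i ∈ A, (1 - ψ i y)) ^ 2)) :=
      (InnerProductSpace.toDual ℝ (EuclideanSpace ℝ (Fin 3))).symm.continuous.comp
        (hPsq.continuous_fderiv one_ne_zero)
    have hv : Continuous fun z : ℝ × EuclideanSpace ℝ (Fin 3) =>
        (Θ z.2 ^ 2) • gradient (fun y => (∏ i ∈ A, (1 - ψ i y)) ^ 2) z.2 :=
      ((hΘ.continuous.comp continuous_snd).pow 2).smul (hg.comp continuous_snd)
    have hU' : AEStronglyMeasurable (fun z : ℝ × EuclideanSpace ℝ (Fin 3) => U z.1 z.2)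
        (volume.restrict (Icc a b ×ˢ univ)) := hUm.restrict
    have hin : AEStronglyMeasurable (fun z : ℝ × EuclideanSpace ℝ (Fin 3) =>
        inner ℝ (U z.1 z.2) ((Θ z.2 ^ 2) • gradient (fun y => (∏ i ∈ A, (1 - ψ i y)) ^ 2) z.2))
        (volume.restrict (Icc a b ×ˢ univ)) := hU'.inner hv.aestronglyMeasurable
    exact h1.aestronglyMeasurable.mul (h3.aestronglyMeasurable.mul hin)
  -- ### assembly
  refine ⟨Integrable.mono' hGint hfm ((ae_restrict_mem hSm).mono fun z hz => ?_), ?_⟩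
  · rw [Real.norm_eq_abs]; exact hbound z hz.1
  · calc ∫ z in Icc a b ×ˢ (univ : Set (EuclideanSpace ℝ (Fin 3))), |η z.1 * (H (Φ z.1 z.2) *
            inner ℝ (U z.1 z.2) ((Θ z.2 ^ 2) • gradient (fun y => (∏ i ∈ A, (1 - ψ i y)) ^ 2) z.2))|
        ≤ ∫ z in Icc a b ×ˢ (univ : Set (EuclideanSpace ℝ (Fin 3))), ∑ i ∈ A, c i *
            ((univ : Set ℝ) ×ˢ (ball (x i) (4 * r i) ∩ ball (0 : EuclideanSpace ℝ (Fin 3)) (2 * R))).indicator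
              (fun z : ℝ × EuclideanSpace ℝ (Fin 3) => ‖U z.1 z.2‖) z :=
          integral_mono_of_nonneg (ae_of_all _ fun z => abs_nonneg _) hGint
            ((ae_restrict_mem hSm).mono fun z hz => hbound z hz.1)
      _ = ∑ i ∈ A, c i * ∫ z in Icc a b ×ˢ (univ : Set (EuclideanSpace ℝ (Fin 3))),
            ((univ : Set ℝ) ×ˢ (ball (x i) (4 * r i) ∩ ball (0 : EuclideanSpace ℝ (Fin 3)) (2 * R))).indicator
              (fun z : ℝ × EuclideanSpace ℝ (Fin 3) => ‖U z.1 z.2‖) z := by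
          rw [integral_finsetSum _ fun i hi => (hterm i hi).1.const_mul (c i)]
          refine Finset.sum_congr rfl fun i _ => ?_
          exact integral_const_mul _ _
      _ = ∑ i ∈ A, c i * ∫ z in Icc a b ×ˢ (ball (x i) (4 * r i) ∩
            ball (0 : EuclideanSpace ℝ (Fin 3)) (2 * R)), ‖U z.1 z.2‖ :=
          Finset.sum_congr rfl fun i hi => by rw [(hterm i hi).2]
      _ = 2 * Mη * H 0 * CΘ ^ 2 * C₀ * ∑ i ∈ A, (r i)⁻¹ * ∫ z in Icc a b ×ˢ (ball (x i) (4 * r i) ∩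
            ball (0 : EuclideanSpace ℝ (Fin 3)) (2 * R)), ‖U z.1 z.2‖ := by
          rw [Finset.mul_sum]
          refine Finset.sum_congr rfl fun i _ => ?_
          rw [hc]
          simp only [div_eq_mul_inv]
          ring

end Summit.NavierStokesRegularity.NavierStokesRegularity.Theorems.AxisymmetricKatoGlobal.EulerScaling

end
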